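import Summits.MatrixMultiplication.MatrixMultiplication.Theorems.SoloInformedTTwoSquare
import HarnessLib

/-!
# `bR(T₂ ⊠ T₂) ≤ 14 < 16` over every field, by Bini's approximate algorithm

Continuation of `SoloInformedTTwoSquare` (`T₂ = tTwo`, the structure tensor of the upper-triangular
`2 × 2` matrices; `bR(T₂) = 4`; `T₂ ⊠ T₂ = tTwoSqInt ∘ finProdFinEquiv`, border rank `≤ 15` there).

## What is proved (kernel-checked certificates, `decide +kernel`)
* `nuTwo_check_seven`, `algBorderRank_kroneckerTensor_tTwo_outerTwo_le`: **`bR(T₂ ⊠ ⟨1,1,2⟩) ≤ 7`**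
  over every field, where `ν₂ := T₂ ⊠ ⟨1,1,2⟩` is "one upper-triangular matrix times two",
  `(α, (Y, Y')) ↦ (αY, αY')` (`8` products naively; the left-regular representation of `T₂` on
  `T₂ ⊕ T₂`).  THE MECHANISM: of its six outputs `ap, ap', aq + br, aq' + br', cr, cr'`
  (`α = (a, b; 0, c)`, `Y = (p, q; 0, r)`, `Y' = (p', q'; 0, r')`), the last four are
  `(b, a; c, 0)·(r, r'; q, q')` — the Bini–Capovani–Lotti–Romani partial matrix product (a `2 × 2`
  matrix with one zero entry times a full `2 × 2` matrix), of border rank `5` (1979, the first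
  approximate algorithm of the subject; [Bürgisser–Clausen–Shokrollahi, (15.6)–(15.8)]).  Hence
  `ν₂ = a ⊗ (p ⊗ P + p' ⊗ P') + BCLR` has `bR(ν₂) ≤ 2 + 5 = 7`, by an INTEGER certificate of order `1`.
  (Over `ℂ` equality holds by Strassen's commutator bound, `rank [X, Y] = 2` for the pencil of `ν₂`;
  not formalised.)
* `tTwoSq_check_fourteen`, `algBorderRank_kroneckerTensor_tTwo_tTwo_le_fourteen`,
  `algBorderRank_kroneckerTensor_tTwo_tTwo_lt_sq`, `algBorderRank_kroneckerTensor_tTwo_add_two_le_sq`: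
  **`bR(T₂ ⊠ T₂) ≤ 14 < 16 = bR(T₂)²`, indeed `bR(T₂ ⊠ T₂) + 2 ≤ bR(T₂)²`, over every field.**
  The `14`-term certificate (entries in `{0, ±1}`, order `1`, multiplier `1`) comes from splitting
  `T₂ = X₁(Y₁Z₁ + Y₂Z₂) + (X₂Z₂ + X₃Z₃)Y₃` into two rank-`2` pieces, each an identity between two of
  the three factors, whence `T₂ ⊠ T₂ = ν₂ + ν₂'` with `ν₂' ≅ T₂ ⊠ ⟨2,1,1⟩`, which is `ν₂` with the
  first two factors exchanged (the transpose anti-automorphism `e₁₁ ↔ e₂₂` of `T₂`): `7 + 7 = 14`.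

## Why it is recorded here
See `SoloInformedTTwoSquare`: `T₂` is a concise, tight, border-rank-`4` tensor of `K³ ⊗ K³ ⊗ K³` —
the smallest border rank at which a Kronecker-square drop is possible — and its square drops by at
least `2` for a one-line reason, while the door tensor `T_{cw,2}` of the same border rank does not
drop at all (`16`, Conner–Harper–Landsberg / `CGLV2022_thm12_upper`).  Strassen's asymptotic rank
conjecture for tight tensors (which contains `ω = 2`) predicts `asymptoticRank T₂ = 3`.
-/

namespace Summit.MatrixMultiplication.MatrixMultiplication.Theorems

open Literature.Computability.AlgebraicComplexity Literature.LinearAlgebra.Matrix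

/-- The `2 × 2 × 2` integer tensor `x₀ y₀ z₀ + x₀ y₁ z₁`: the (padded) matrix multiplication tensor
`⟨1,1,2⟩`, an identity between the second and third factors. [folklore] -/
def outerTwoInt : Fin 2 → Fin 2 → Fin 2 → ℤ :=
  ApproxCert.ofEntries 2 2 2 [((0, 0, 0), 1), ((0, 1, 1), 1)]

/-- `outerTwoInt` over a commutative ring. [folklore] -/
def outerTwo (K : Type*) [CommRing K] : Fin 2 → Fin 2 → Fin 2 → K := fun i j l => (outerTwoInt i j l : K)

/-- `ν₂ := T₂ ⊠ ⟨1,1,2⟩` — the bilinear map "one upper-triangular matrix times two",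
`(α, (Y, Y')) ↦ (αY, αY')` on `T₂(K) × T₂(K)²`, i.e. the left-regular representation of `T₂` on
`T₂ ⊕ T₂` — as an integer tensor of format `6 × 6 × 6`, index `2·a + i` (only the input coordinates
`0, 2, 4` of the first factor are used). [folklore] -/
def nuTwoInt : Fin 6 → Fin 6 → Fin 6 → ℤ :=
  ApproxCert.ofEntries 6 6 6
    [((0, 0, 0), 1), ((0, 1, 1), 1), ((0, 2, 2), 1), ((0, 3, 3), 1),
     ((2, 4, 2), 1), ((2, 5, 3), 1), ((4, 4, 4), 1), ((4, 5, 5), 1)]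

/-- Entrywise: `nuTwoInt (2a+i) (2b+i') (2c+j) = tTwoInt a b c · outerTwoInt i i' j`. [folklore] -/
theorem nuTwoInt_finProdFinEquiv :
    ∀ a b c : Fin 3 × Fin 2, nuTwoInt (finProdFinEquiv a) (finProdFinEquiv b) (finProdFinEquiv c) =
      tTwoInt a.1 b.1 c.1 * outerTwoInt a.2 b.2 c.2 := by
  decide +kernel

/-- `T₂ ⊠ ⟨1,1,2⟩` is the relabelling of `nuTwoInt` by `finProdFinEquiv`. [folklore] -/
theorem kroneckerTensor_tTwo_outerTwo (K : Type*) [CommRing K] :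
    kroneckerTensor (tTwo K) (outerTwo K) =
      fun a b c => (nuTwoInt (finProdFinEquiv a) (finProdFinEquiv b) (finProdFinEquiv c) : K) := by
  funext a b c
  rw [kroneckerTensor_apply, nuTwoInt_finProdFinEquiv]
  simp [tTwo, outerTwo]

/-- **An integer `7`-term approximate decomposition of `ν₂ = T₂ ⊠ ⟨1,1,2⟩` of order `1`.**
With `α = (a, b; 0, c)`, `Y = (p, q; 0, r)`, `Y' = (p', q'; 0, r')` the six outputs are `ap, ap'` and
`aq + br, aq' + br', cr, cr'`; the last four are the product of `(b, a; c, 0)` with the full matrix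
`(r, r'; q, q')`, i.e. the Bini–Capovani–Lotti–Romani partial matrix multiplication (a `2 × 2` matrix
with one zero entry times a full `2 × 2` matrix), of border rank `5`; the five products below are
BCLR's `F₁(ε)` [Bürgisser–Clausen–Shokrollahi, *Algebraic Complexity Theory*, (15.6) ff., p. 378],
the first two are `a·p·(εP)` and `a·p'·(εP')`. [cite: BurgisserClausenShokrollahi1997, §15.2] -/
theorem nuTwo_check_seven :
    ApproxCert.check 6 6 6 7 1 1 nuTwoInt
      (![![[1], [], [], [], [], []],
        ![[1], [], [], [], [], []],
        ![[1], [], [0, 1], [], [], []],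
        ![[], [], [0, 1], [], [1], []],
        ![[-1], [], [], [], [], []],
        ![[], [], [], [], [-1], []],
        ![[1], [], [], [], [1], []]])
      (![![[1], [], [], [], [], []],
        ![[], [1], [], [], [], []],
        ![[], [], [], [0, 1], [], [1]],
        ![[], [], [], [], [1], []],
        ![[], [], [], [], [], [1]],
        ![[], [], [0, 1], [], [1], [1]],
        ![[], [], [0, 1], [], [], [1]]])
      (![![[0, 1], [], [], [], [], []],
        ![[], [0, 1], [], [], [], []],
        ![[], [], [], [1], [], []],
        ![[], [], [1], [], [0, 1], []],
        ![[], [], [1], [1], [], [0, 1]],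
        ![[], [], [1], [], [], []],
        ![[], [], [1], [], [], [0, 1]]]) = true := by
  decide +kernel

/-- **`bR(ν₂) ≤ 7`** over every commutative ring (as the explicit tensor `nuTwoInt`).
(Over `ℂ` equality holds by Strassen's commutator bound: the pencil of `ν₂` is the left-regular
representation of the non-commutative algebra `T₂` on `T₂²`, `rank [X, Y] = 2`; not formalised here.)
[cite: BurgisserClausenShokrollahi1997, §15.2] -/
theorem algBorderRank_nuTwo_le_seven (K : Type*) [Field K] :
    algBorderRank (fun i j l => (nuTwoInt i j l : K)) ≤ 7 :=
  ApproxCert.algBorderRank_le_of_check_one K nuTwo_check_seven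

/-- **`bR(T₂ ⊠ ⟨1,1,2⟩) ≤ 7`** over every field, Kronecker form. [cite: BurgisserClausenShokrollahi1997, §15.2] -/
theorem algBorderRank_kroneckerTensor_tTwo_outerTwo_le (K : Type*) [Field K] :
    algBorderRank (kroneckerTensor (tTwo K) (outerTwo K)) ≤ 7 := by
  rw [kroneckerTensor_tTwo_outerTwo]
  have h := algBorderRank_reindex (ι' := Fin 3 × Fin 2) (κ' := Fin 3 × Fin 2) (μ' := Fin 3 × Fin 2)
    finProdFinEquiv finProdFinEquiv finProdFinEquiv (fun i j l => (nuTwoInt i j l : K))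
  exact h.trans_le (algBorderRank_nuTwo_le_seven K)

/-- **An integer `14`-term approximate decomposition of `T₂ ⊠ T₂` of order `1`** (entries in
`{0, ±1}`, multiplier `D = 1`), from the splitting `T₂ = X₁(Y₁Z₁ + Y₂Z₂) + (X₂Z₂ + X₃Z₃)Y₃` into two
rank-`2` pieces, each an identity between two factors: `T₂ ⊠ T₂ = ν₂ + ν₂'` with
`ν₂ = X₁(Y₁Z₁ + Y₂Z₂) ⊠ T₂ ≅ T₂ ⊠ ⟨1,1,2⟩` (first Kronecker digits `A = 0`, `B = C ∈ {0, 1}`) and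
`ν₂' = (X₂Z₂ + X₃Z₃)Y₃ ⊠ T₂ ≅ T₂ ⊠ ⟨2,1,1⟩` (first digits `B = 2`, `A = C ∈ {1, 2}`), which is `ν₂` with
the first two factors exchanged (the transpose anti-automorphism of `T₂`); each piece is
`2 + 5 = 7` terms as in `nuTwo_check_seven` (for `ν₂'` the BCLR block is the full matrix
`(a, b; a', b')` times the triangular `(p, q; 0, r)`). [cite: BurgisserClausenShokrollahi1997, §15.2] -/
theorem tTwoSq_check_fourteen :
    ApproxCert.check 9 9 9 14 1 1 tTwoSqInt
      (![![[1], [], [], [], [], [], [], [], []],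
        ![[1], [], [], [], [], [], [], [], []],
        ![[1], [0, 1], [], [], [], [], [], [], []],
        ![[], [0, 1], [1], [], [], [], [], [], []],
        ![[-1], [], [], [], [], [], [], [], []],
        ![[], [], [-1], [], [], [], [], [], []],
        ![[1], [], [1], [], [], [], [], [], []],
        ![[], [], [], [], [], [1], [], [], []],
        ![[], [], [], [], [], [], [], [], [1]],
        ![[], [], [], [], [], [], [1], [0, 1], []],
        ![[], [], [], [1], [], [], [], [], []],
        ![[], [], [], [], [], [], [-1], [], []],
        ![[], [], [], [-1], [0, -1], [], [-1], [], []],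
        ![[], [], [], [], [0, 1], [], [1], [], []]])
      (![![[1], [], [], [], [], [], [], [], []],
        ![[], [], [], [1], [], [], [], [], []],
        ![[], [], [], [], [0, 1], [1], [], [], []],
        ![[], [], [1], [], [], [], [], [], []],
        ![[], [], [], [], [], [1], [], [], []],
        ![[], [0, 1], [1], [], [], [1], [], [], []],
        ![[], [0, 1], [], [], [], [1], [], [], []],
        ![[], [], [], [], [], [], [], [], [1]],
        ![[], [], [], [], [], [], [], [], [1]],
        ![[], [], [], [], [], [], [], [0, 1], [1]],
        ![[], [], [], [], [], [], [1], [0, 1], []],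
        ![[], [], [], [], [], [], [], [], [1]],
        ![[], [], [], [], [], [], [1], [], []],
        ![[], [], [], [], [], [], [1], [], [1]]])
      (![![[0, 1], [], [], [], [], [], [], [], []],
        ![[], [], [], [0, 1], [], [], [], [], []],
        ![[], [], [], [], [1], [], [], [], []],
        ![[], [1], [0, 1], [], [], [], [], [], []],
        ![[], [1], [], [], [1], [0, 1], [], [], []],
        ![[], [1], [], [], [], [], [], [], []],
        ![[], [1], [], [], [], [0, 1], [], [], []],
        ![[], [], [], [], [], [0, 1], [], [], []],
        ![[], [], [], [], [], [], [], [], [0, 1]],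
        ![[], [], [], [], [], [], [], [1], []],
        ![[], [], [], [0, 1], [1], [], [], [], []],
        ![[], [], [], [], [1], [], [0, 1], [1], []],
        ![[], [], [], [], [1], [], [], [], []],
        ![[], [], [], [], [1], [], [0, 1], [], []]]) = true := by
  decide +kernel

/-- **`bR(T₂ ⊠ T₂) ≤ 14`** over every field (as the explicit tensor `tTwoSqInt`).
[cite: BurgisserClausenShokrollahi1997, §15.2] -/
theorem algBorderRank_tTwoSq_le_fourteen (K : Type*) [Field K] :
    algBorderRank (fun i j l => (tTwoSqInt i j l : K)) ≤ 14 :=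
  ApproxCert.algBorderRank_le_of_check_one K tTwoSq_check_fourteen

/-- **`bR(T₂ ⊠ T₂) ≤ 14`** over every field, Kronecker form. [cite: BurgisserClausenShokrollahi1997, §15.2] -/
theorem algBorderRank_kroneckerTensor_tTwo_tTwo_le_fourteen (K : Type*) [Field K] :
    algBorderRank (kroneckerTensor (tTwo K) (tTwo K)) ≤ 14 := by
  rw [kroneckerTensor_tTwo]
  have h := algBorderRank_reindex (ι' := Fin 3 × Fin 3) (κ' := Fin 3 × Fin 3) (μ' := Fin 3 × Fin 3)
    finProdFinEquiv finProdFinEquiv finProdFinEquiv (fun i j l => (tTwoSqInt i j l : K))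
  exact h.trans_le (algBorderRank_tTwoSq_le_fourteen K)

/-- **Strict submultiplicativity of border rank under the Kronecker square for `T₂`, over every
field:** `bR(T₂ ⊠ T₂) ≤ 14 < 16 = bR(T₂)²`. `T₂` is a concise tensor of `K³ ⊗ K³ ⊗ K³` of (minimal
non-minimal) border rank `4`; compare `bR(T_{cw,2} ⊠ T_{cw,2}) = 16` over `ℂ` (`CGLV2022_thm12_upper`
and Conner–Harper–Landsberg). [cite: BurgisserClausenShokrollahi1997, §15.2] -/
theorem algBorderRank_kroneckerTensor_tTwo_tTwo_lt_sq (K : Type*) [Field K] :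
    algBorderRank (kroneckerTensor (tTwo K) (tTwo K)) < algBorderRank (tTwo K) ^ 2 := by
  rw [algBorderRank_tTwo]
  exact lt_of_le_of_lt (algBorderRank_kroneckerTensor_tTwo_tTwo_le_fourteen K) (by norm_num)

/-- The gap is at least two: `bR(T₂ ⊠ T₂) + 2 ≤ bR(T₂)²` over every field.
[cite: BurgisserClausenShokrollahi1997, §15.2] -/
theorem algBorderRank_kroneckerTensor_tTwo_add_two_le_sq (K : Type*) [Field K] :
    algBorderRank (kroneckerTensor (tTwo K) (tTwo K)) + 2 ≤ algBorderRank (tTwo K) ^ 2 := by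
  rw [algBorderRank_tTwo]
  have := algBorderRank_kroneckerTensor_tTwo_tTwo_le_fourteen K
  omega

end Summit.MatrixMultiplication.MatrixMultiplication.Theorems
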